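import Literature.Algebra.Homology.OrderedCechSystemMap
import HarnessLib

/-!
# The ordered Čech complex of a system of modules, III: tensoring with a module, restriction, pruning
# (Görtz–Wedhorn II, Def. 21.68, Thm. 23.133 Step (I); EGA III 6.10.5; The Stacks Project, Tag 01FG)

Sequel to `Algebra/Homology/OrderedCechSystem(Map)`:
* tensoring a system with a module: `OrderedCech.lTensorSys N M = (s ↦ N ⊗_A M s)` and, for FLAT `M s`, the
  short exact sequence of complexes `0 → Č(N₁ ⊗ M) → Č(N₂ ⊗ M) → Č(N₃ ⊗ M) → 0` attached to an exact triple
  `N₁ ↪ N₂ ↠ N₃` (**`shortExact_lTensorSysSC`**) — the input of the dévissage of Görtz–Wedhorn II,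
  Thm. 23.133, Step (I) / EGA III 6.10.5 over a noetherian base; `lTensorSysIsoSelf` (`A ⊗_A M ≅ M`);
* restriction of a system to a sub-family along an order embedding `e : κ ↪o ι` (`comapSys`,
  `SysCochain.restrict/extend`) and **pruning of members with zero module**: if `M s = 0` whenever `s`
  meets the complement of the range of `e`, restriction is an isomorphism of complexes (`sysComplexRestrictIso`).
Elementary and proved; no named facts (Mathlib: `lTensor_exact`, `Module.Flat.lTensor_preserves_injective_linearMap`).

## References

* U. Görtz, T. Wedhorn, *Algebraic Geometry II: Cohomology of Schemes*, Springer Spektrum (2023),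
  doi:10.1007/978-3-658-43031-3: Def. 21.68 (p. 180); Thm. 23.133, proof, Step (I) (p. 354). [GortzWedhorn2023]
* A. Grothendieck, EGA III₂ (Publ. Math. IHÉS 17, 1963), 6.10.5. [EGA3]
* The Stacks Project, Tag 01FG. [StacksProject]
-/

universe v u

open CategoryTheory TensorProduct

set_option backward.isDefEq.respectTransparency false

noncomputable section

namespace Literature.Algebra.Homology

namespace OrderedCech

variable {ι : Type} [LinearOrder ι] {A : Type u} [CommRing A]

/-! ### Tensoring a system with a module; the dévissage short exact sequences -/

section LTensor

variable (N : Type v) [AddCommGroup N] [Module A N] (M : Finset ι ⥤ ModuleCat.{v} A)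

/-- The system `s ↦ N ⊗_A M s` (restriction maps `1 ⊗ res`). [folklore] [cite: GortzWedhorn2023, Thm. 23.133 proof Step (I) (p. 354)] -/
def lTensorSys : Finset ι ⥤ ModuleCat.{v} A where
  obj s := ModuleCat.of A (N ⊗[A] M.obj s)
  map {s t} h := ModuleCat.ofHom ((M.map h).hom.lTensor N)
  map_id s := by
    apply ModuleCat.hom_ext
    rw [ModuleCat.hom_ofHom, M.map_id, ModuleCat.hom_id, LinearMap.lTensor_id]
    rfl
  map_comp {s t r} f g := by
    apply ModuleCat.hom_ext
    rw [ModuleCat.hom_ofHom, M.map_comp, ModuleCat.hom_comp, LinearMap.lTensor_comp, ModuleCat.hom_comp,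
      ModuleCat.hom_ofHom, ModuleCat.hom_ofHom]

omit [LinearOrder ι] in
/-- The objects of the tensored system. [folklore] [cite: GortzWedhorn2023, Thm. 23.133 proof Step (I) (p. 354)] -/
@[simp] theorem lTensorSys_obj (s : Finset ι) : (lTensorSys N M).obj s = ModuleCat.of A (N ⊗[A] M.obj s) := rfl

omit [LinearOrder ι] in
/-- The maps of the tensored system. [folklore] [cite: GortzWedhorn2023, Thm. 23.133 proof Step (I) (p. 354)] -/
@[simp] theorem lTensorSys_map_hom {s t : Finset ι} (h : s ⟶ t) :
    ((lTensorSys N M).map h).hom = (M.map h).hom.lTensor N := rfl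

variable {N} {N' N'' : Type v} [AddCommGroup N'] [Module A N'] [AddCommGroup N''] [Module A N'']

/-- A linear map `N → N'` induces a morphism of tensored systems `N ⊗ M ⟶ N' ⊗ M`. [folklore] [cite: GortzWedhorn2023, Thm. 23.133 proof Step (I) (p. 354)] -/
def lTensorSysMap (f : N →ₗ[A] N') : lTensorSys N M ⟶ lTensorSys N' M where
  app s := ModuleCat.ofHom (f.rTensor (M.obj s))
  naturality {s t} h := by
    apply ModuleCat.hom_ext
    apply TensorProduct.ext'
    intro n y
    rfl

omit [LinearOrder ι] in
/-- Components of `lTensorSysMap`. [folklore] [cite: GortzWedhorn2023, Thm. 23.133 proof Step (I) (p. 354)] -/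
@[simp] theorem lTensorSysMap_app_hom (f : N →ₗ[A] N') (s : Finset ι) :
    ((lTensorSysMap M f).app s).hom = f.rTensor (M.obj s) := rfl

omit [LinearOrder ι] in
/-- `lTensorSysMap` is compatible with composition. [folklore] [cite: GortzWedhorn2023, Thm. 23.133 proof Step (I) (p. 354)] -/
theorem lTensorSysMap_comp (f : N →ₗ[A] N') (g : N' →ₗ[A] N'') :
    lTensorSysMap M (g ∘ₗ f) = lTensorSysMap M f ≫ lTensorSysMap M g := by
  ext s : 2
  apply ModuleCat.hom_ext
  rw [NatTrans.comp_app, ModuleCat.hom_comp, lTensorSysMap_app_hom, lTensorSysMap_app_hom,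
    lTensorSysMap_app_hom]
  exact LinearMap.rTensor_comp (M.obj s) g f

omit [LinearOrder ι] in
/-- `lTensorSysMap` of the zero map is zero. [folklore] [cite: GortzWedhorn2023, Thm. 23.133 proof Step (I) (p. 354)] -/
theorem lTensorSysMap_zero : lTensorSysMap M (0 : N →ₗ[A] N') = 0 := by
  ext s : 2
  apply ModuleCat.hom_ext
  rw [lTensorSysMap_app_hom, LinearMap.rTensor_zero]
  rfl

/-- The short complex of ordered Čech complexes `Č(N ⊗ M) → Č(N' ⊗ M) → Č(N'' ⊗ M)` attached to a
composable pair `N → N' → N''` with zero composite. [folklore] [cite: GortzWedhorn2023, Thm. 23.133 proof Step (I) (p. 354)] -/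
def lTensorSysSC (f : N →ₗ[A] N') (g : N' →ₗ[A] N'') (hfg : g ∘ₗ f = 0) :
    ShortComplex (CochainComplex (ModuleCat.{v} A) ℤ) :=
  sysSC (lTensorSysMap M f) (lTensorSysMap M g)
    (by rw [← lTensorSysMap_comp, hfg, lTensorSysMap_zero])

/-- **Dévissage input: for a system of FLAT modules, an exact triple `N ↪ N' ↠ N''` gives a short exact
sequence of ordered Čech complexes `0 → Č(N ⊗ M) → Č(N' ⊗ M) → Č(N'' ⊗ M) → 0`** (flatness of the
`M s` makes `− ⊗ M s` exact; Görtz–Wedhorn II, Thm. 23.133, proof, Step (I) / EGA III 6.10.5).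
[cite: GortzWedhorn2023, Thm. 23.133, proof, Step (I) (p. 354)] -/
theorem shortExact_lTensorSysSC [Fintype ι] (hflat : ∀ s : Finset ι, s.Nonempty → Module.Flat A (M.obj s))
    (f : N →ₗ[A] N') (g : N' →ₗ[A] N'') (hf : Function.Injective f) (hg : Function.Surjective g)
    (hfg : Function.Exact f g) :
    (lTensorSysSC M f g (LinearMap.ext fun x => (hfg (f x)).2 ⟨x, rfl⟩)).ShortExact := by
  refine shortExact_sysSC _ _ _ ?_ ?_ ?_
  · intro s hs
    haveI := hflat s hs
    exact Module.Flat.rTensor_preserves_injective_linearMap f hf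
  · intro s _
    exact LinearMap.rTensor_surjective (M.obj s) hg
  · intro s _
    exact rTensor_exact (M.obj s) hfg hg

/-- A linear isomorphism `N ≃ N'` induces an isomorphism of tensored systems. [folklore] [cite: GortzWedhorn2023, Thm. 23.133 proof Step (I) (p. 354)] -/
def lTensorSysIso (e : N ≃ₗ[A] N') : lTensorSys N M ≅ lTensorSys N' M where
  hom := lTensorSysMap M e.toLinearMap
  inv := lTensorSysMap M e.symm.toLinearMap
  hom_inv_id := by
    rw [← lTensorSysMap_comp]
    have : e.symm.toLinearMap ∘ₗ e.toLinearMap = LinearMap.id := by ext x; simp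
    rw [this]
    ext s : 2
    apply ModuleCat.hom_ext
    rw [lTensorSysMap_app_hom, LinearMap.rTensor_id]
    rfl
  inv_hom_id := by
    rw [← lTensorSysMap_comp]
    have : e.toLinearMap ∘ₗ e.symm.toLinearMap = LinearMap.id := by ext x; simp
    rw [this]
    ext s : 2
    apply ModuleCat.hom_ext
    rw [lTensorSysMap_app_hom, LinearMap.rTensor_id]
    rfl

end LTensor

/-! ### Restriction to a sub-family; pruning members with zero sections -/

section Restrict

variable {κ : Type} [LinearOrder κ] (e : κ ↪o ι) (M : Finset ι ⥤ ModuleCat.{v} A)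

omit [LinearOrder ι] [LinearOrder κ] in
/-- `s ↦ e(s)` is monotone. [folklore] [cite: GortzWedhorn2023, Thm. 23.133 proof Step (I) (p. 354)] -/
theorem monotone_finsetMap (e : κ ↪ ι) : Monotone fun s : Finset κ => s.map e :=
  fun _ _ h => Finset.map_subset_map.2 h

/-- The functor `Finset κ ⥤ Finset ι`, `s ↦ e(s)`. [folklore] [cite: GortzWedhorn2023, Thm. 23.133 proof Step (I) (p. 354)] -/
def finsetMapFunctor : Finset κ ⥤ Finset ι := (monotone_finsetMap e.toEmbedding).functor

/-- **The restricted system `s ↦ M (e s)`** on the sub-index set `κ`. [folklore] [cite: GortzWedhorn2023, Thm. 23.133 proof Step (I) (p. 354)] -/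
def comapSys : Finset κ ⥤ ModuleCat.{v} A := finsetMapFunctor e ⋙ M

/-- The objects of the restricted system. [folklore] [cite: GortzWedhorn2023, Thm. 23.133 proof Step (I) (p. 354)] -/
@[simp] theorem comapSys_obj (s : Finset κ) : (comapSys e M).obj s = M.obj (s.map e.toEmbedding) := rfl

/-- The maps of the restricted system. [folklore] [cite: GortzWedhorn2023, Thm. 23.133 proof Step (I) (p. 354)] -/
theorem comapSys_map {s t : Finset κ} (h : s ⟶ t) :
    (comapSys e M).map h = M.map (homOfLE (monotone_finsetMap e.toEmbedding h.le)) := rfl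

/-- **Restriction of cochains** to the simplices of the sub-family. [folklore] [cite: GortzWedhorn2023, Thm. 23.133 proof Step (I) (p. 354)] -/
def SysCochain.restrict (n : ℤ) : SysCochain M n →ₗ[A] SysCochain (comapSys e M) n where
  toFun g σ := g (Simplex.map e σ)
  map_add' _ _ := rfl
  map_smul' _ _ := rfl

/-- The value of a restricted cochain. [folklore] [cite: GortzWedhorn2023, Thm. 23.133 proof Step (I) (p. 354)] -/
@[simp] theorem SysCochain.restrict_apply {n : ℤ} (g : SysCochain M n) (σ : Simplex κ n) :
    SysCochain.restrict e M n g σ = g (Simplex.map e σ) := rfl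

/-- Restriction and `ext0At`. [folklore] [cite: GortzWedhorn2023, Thm. 23.133 proof Step (I) (p. 354)] -/
theorem SysCochain.ext0At_restrict {n : ℤ} (g : SysCochain M n) (s t : Finset κ) :
    (SysCochain.restrict e M n g).ext0At s t = g.ext0At (s.map e.toEmbedding) (t.map e.toEmbedding) := by
  unfold SysCochain.ext0At
  by_cases h : (s.Nonempty ∧ (s.card : ℤ) = n + 1) ∧ s ⊆ t
  · have h' : ((s.map e.toEmbedding).Nonempty ∧ ((s.map e.toEmbedding).card : ℤ) = n + 1) ∧
        s.map e.toEmbedding ⊆ t.map e.toEmbedding :=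
      ⟨⟨Finset.map_nonempty.2 h.1.1, by rw [Finset.card_map]; exact h.1.2⟩, Finset.map_subset_map.2 h.2⟩
    rw [dif_pos h, dif_pos h']
    rfl
  · have h' : ¬(((s.map e.toEmbedding).Nonempty ∧ ((s.map e.toEmbedding).card : ℤ) = n + 1) ∧
        s.map e.toEmbedding ⊆ t.map e.toEmbedding) := by
      rwa [Finset.map_nonempty, Finset.card_map, Finset.map_subset_map]
    rw [dif_neg h, dif_neg h']

/-- **Restriction commutes with the Čech differential** (the signs agree because `e` is strictly
monotone, ★ `sign_map`). [folklore] [cite: GortzWedhorn2023, Thm. 23.133 proof Step (I) (p. 354)] -/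
theorem sysD_restrict {n : ℤ} (g : SysCochain M n) :
    sysD (comapSys e M) n (SysCochain.restrict e M n g) = SysCochain.restrict e M (n + 1) (sysD M n g) := by
  classical
  funext σ
  rw [sysD_apply, SysCochain.restrict_apply, sysD_apply]
  change _ = ∑ a ∈ σ.1.map e.toEmbedding, sign A (σ.1.map e.toEmbedding) a •
    g.ext0At ((σ.1.map e.toEmbedding).erase a) (σ.1.map e.toEmbedding)
  rw [Finset.sum_map]
  refine Finset.sum_congr rfl fun a _ => ?_
  rw [SysCochain.ext0At_restrict, RelEmbedding.coe_toEmbedding, sign_map, Finset.map_erase,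
    RelEmbedding.coe_toEmbedding]

/-- **The restriction morphism `Č(M) → Č(M ∘ e)`.** [folklore] [cite: GortzWedhorn2023, Thm. 23.133 proof Step (I) (p. 354)] -/
def sysRestrictMap : sysComplex M ⟶ sysComplex (comapSys e M) :=
  CochainComplex.ofHom (fun n => ModuleCat.ofHom (SysCochain.restrict e M n)) fun n => by
    rw [sysComplex_d, sysComplex_d]
    ext g
    exact sysD_restrict e M g

/-- Components of the restriction morphism. [folklore] [cite: GortzWedhorn2023, Thm. 23.133 proof Step (I) (p. 354)] -/
@[simp] theorem sysRestrictMap_f (n : ℤ) : (sysRestrictMap e M).f n = ModuleCat.ofHom (SysCochain.restrict e M n) := rfl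

/-- Simplices are determined by their vertex sets; mapping along `e` is injective. [folklore] [cite: GortzWedhorn2023, Thm. 23.133 proof Step (I) (p. 354)] -/
theorem Simplex.map_injective {n : ℤ} : Function.Injective (Simplex.map (n := n) e) := by
  intro σ τ h
  apply Subtype.ext
  exact Finset.map_injective e.toEmbedding (congrArg Subtype.val h)

/-- Transport of a value of `g'` along an equality of simplices (through `M.map` of the inclusion). [folklore] [cite: GortzWedhorn2023, Thm. 23.133 proof Step (I) (p. 354)] -/
theorem map_apply_eq_of_eq {N : Finset κ ⥤ ModuleCat.{v} A} {n : ℤ} (g' : SysCochain N n)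
    {σ τ : Simplex κ n} (h : σ = τ) :
    (N.map (homOfLE (le_of_eq (congrArg Subtype.val h)))).hom (g' σ) = g' τ := by
  subst h
  have : homOfLE (le_of_eq (congrArg Subtype.val (rfl : σ = σ))) = 𝟙 σ.1 := rfl
  rw [this, N.map_id]
  rfl

/-- Extension by zero of a cochain of the sub-family to the whole family (values on simplices inside
`e(κ)` transported, zero elsewhere). [folklore] [cite: GortzWedhorn2023, Thm. 23.133 proof Step (I) (p. 354)] -/
def SysCochain.extend {n : ℤ} (g' : SysCochain (comapSys e M) n) : SysCochain M n := fun σ =>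
  haveI := Classical.dec
  if h : ∃ τ : Simplex κ n, (Simplex.map e τ).1 ⊆ σ.1 ∧ σ.1 ⊆ (Simplex.map e τ).1 then
    (M.map (homOfLE h.choose_spec.1)).hom (g' h.choose)
  else 0

/-- Restricting the extension gives back the cochain. [folklore] [cite: GortzWedhorn2023, Thm. 23.133 proof Step (I) (p. 354)] -/
theorem SysCochain.restrict_extend {n : ℤ} (g' : SysCochain (comapSys e M) n) :
    SysCochain.restrict e M n (SysCochain.extend e M g') = g' := by
  classical
  funext τ
  rw [SysCochain.restrict_apply]
  unfold SysCochain.extend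
  have hex : ∃ τ' : Simplex κ n, (Simplex.map e τ').1 ⊆ (Simplex.map e τ).1 ∧
      (Simplex.map e τ).1 ⊆ (Simplex.map e τ').1 := ⟨τ, subset_rfl, subset_rfl⟩
  rw [dif_pos hex]
  have hτ : hex.choose = τ :=
    Simplex.map_injective e (Subtype.ext (subset_antisymm hex.choose_spec.1 hex.choose_spec.2))
  -- transport through `comapSys`: `M.map (e τ' ⊆ e τ) = (comapSys e M).map (τ' ⊆ τ)`
  have key : ∀ (τ' : Simplex κ n) (h₁ : (Simplex.map e τ').1 ⊆ (Simplex.map e τ).1) (hτ' : τ' = τ),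
      (M.map (homOfLE h₁)).hom (g' τ') = g' τ := by
    intro τ' h₁ hτ'
    subst hτ'
    exact map_apply_eq_of_eq (N := comapSys e M) g' rfl
  exact key _ _ hτ

/-- **Restriction of cochains is surjective.** [folklore] [cite: GortzWedhorn2023, Thm. 23.133 proof Step (I) (p. 354)] -/
theorem SysCochain.restrict_surjective (n : ℤ) : Function.Surjective (SysCochain.restrict e M n) :=
  fun g' => ⟨SysCochain.extend e M g', SysCochain.restrict_extend e M g'⟩

/-- **Restriction of cochains is injective when the members outside `e(κ)` vanish** (every simplex
not in the image of `e` carries the zero module). [folklore] [cite: GortzWedhorn2023, Thm. 23.133 proof Step (I) (p. 354)] -/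
theorem SysCochain.restrict_injective (n : ℤ)
    (h0 : ∀ s : Finset ι, s.Nonempty → (¬ ∃ s' : Finset κ, s'.map e.toEmbedding = s) → Subsingleton (M.obj s)) :
    Function.Injective (SysCochain.restrict e M n) := by
  intro g₁ g₂ h
  funext σ
  by_cases hσ : ∃ s' : Finset κ, s'.map e.toEmbedding = σ.1
  · obtain ⟨s', hs'⟩ := hσ
    have hs'' : s'.Nonempty ∧ (s'.card : ℤ) = n + 1 := by
      refine ⟨?_, ?_⟩
      · rw [← Finset.map_nonempty (f := e.toEmbedding), hs']; exact σ.2.1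
      · rw [← Finset.card_map e.toEmbedding, hs']; exact σ.2.2
    have hmap : Simplex.map e ⟨s', hs''⟩ = σ := Subtype.ext hs'
    have := congr_fun h ⟨s', hs''⟩
    rw [SysCochain.restrict_apply, SysCochain.restrict_apply] at this
    subst hmap
    exact this
  · haveI := h0 σ.1 σ.2.1 hσ
    exact Subsingleton.elim _ _

/-- **Pruning: if the members outside the sub-family vanish, restriction `Č(M) → Č(M ∘ e)` is an
isomorphism of complexes** (e.g. dropping the members of a cover with empty open). [folklore] [cite: GortzWedhorn2023, Thm. 23.133 proof Step (I) (p. 354)] -/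
theorem isIso_sysRestrictMap
    (h0 : ∀ s : Finset ι, s.Nonempty → (¬ ∃ s' : Finset κ, s'.map e.toEmbedding = s) → Subsingleton (M.obj s)) :
    IsIso (sysRestrictMap e M) := by
  haveI : ∀ n, IsIso ((sysRestrictMap e M).f n) := fun n => by
    rw [sysRestrictMap_f]
    exact (ConcreteCategory.isIso_iff_bijective _).2
      ⟨SysCochain.restrict_injective e M n h0, SysCochain.restrict_surjective e M n⟩
  exact HomologicalComplex.Hom.isIso_of_components _

/-- The pruning isomorphism `Č(M) ≅ Č(M ∘ e)`. [folklore] [cite: GortzWedhorn2023, Thm. 23.133 proof Step (I) (p. 354)] -/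
def sysRestrictIso
    (h0 : ∀ s : Finset ι, s.Nonempty → (¬ ∃ s' : Finset κ, s'.map e.toEmbedding = s) → Subsingleton (M.obj s)) :
    sysComplex M ≅ sysComplex (comapSys e M) :=
  haveI := isIso_sysRestrictMap e M h0
  asIso (sysRestrictMap e M)

end Restrict

section LTensorSelf

variable {A : Type v} [CommRing A] (M : Finset ι ⥤ ModuleCat.{v} A)

/-- **`A ⊗_A M ≅ M`** as systems (ring and modules in the same universe). [folklore] [cite: GortzWedhorn2023, Thm. 23.133 proof Step (I) (p. 354)] -/
def lTensorSysIsoSelf : lTensorSys A M ≅ M :=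
  NatIso.ofComponents (fun s => (TensorProduct.lid A (M.obj s)).toModuleIso) fun {s t} h => by
    apply ModuleCat.hom_ext
    apply TensorProduct.ext'
    intro a y
    change (TensorProduct.lid A (M.obj t)) ((LinearMap.lTensor A (M.map h).hom) (a ⊗ₜ y)) =
      (M.map h).hom ((TensorProduct.lid A (M.obj s)) (a ⊗ₜ y))
    rw [LinearMap.lTensor_tmul, TensorProduct.lid_tmul, TensorProduct.lid_tmul, map_smul]

end LTensorSelf

end OrderedCech

end Literature.Algebra.Homology

end
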